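import Mathlib
import HarnessLib
import Literature.Analysis.PDE.BanachIndicatrixLaplacianBound
import Literature.Analysis.FluidPDE.DeviatoricHessian
import Literature.Analysis.FluidPDE.AncientSimilarityVorticity
import Literature.Analysis.FluidPDE.TaoEnstrophyLocalisation
import Literature.Analysis.FluidPDE.LocalHelmholtzSlice
import Summits.NavierStokesRegularity.NavierStokesRegularity.Theorems.UnthreadedDoorNetFluxSphericalExtremumLaplacian

/-!
# Route `UnthreadedDoor`, crux `PoloidalLiouville` (stmt-NavierStokesRegularity-1222), WALL W1 — crux idea «indicatrix-bound»,
# Λ-0b+c bridge, part (T2b): step (v) — THE SPHERE LAPLACIAN OF THE PULLED-BACK SLICE POTENTIAL IS `−⟪y, curl curl u⟫`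

Step (v) of the M-Lean bridge Λ-0b+c (`IndicatrixLeHessian` ⇐ Polterovich–Sodin 2007 Thm 1.5; `Cruxes/PoloidalLiouville/IndicatrixSketch.lean`
v1.7.5, docstring of `IndicatrixLeHessian`).  The typer's `Literature.Analysis.PDE.sphereLaplacian F σ = Δ (y ↦ F (‖y‖⁻¹ y)) σ` is computed at a
unit vector `σ` by the second-order chain rule through the normalisation `N(y) = ‖y‖⁻¹ y` (first-order calculus of `N` on `ℝ³ ∖ {0}` as in
`Literature/Geometry/Riemannian/SpherePresentation.lean`, restated here on `ℝ³` because that module is not built on the farm)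
in a radial orthonormal frame (`NetFlux.exists_orthonormalBasis_radial`):

* `fderiv_fderiv_normalize_apply_self` — `D²N(σ)[h,h] = −2⟪σ,h⟫ h + (3⟪σ,h⟫² − ‖h‖²) σ` for `‖σ‖ = 1`;
* ★ `laplacian_comp_normalize` — `Δ (F ∘ N)(σ) = Δ F(σ) − D²F(σ)[σ,σ] − 2 DF(σ)[σ]` for `‖σ‖ = 1` and `F ∈ C²` at `σ`
  (the classical `Δ_{S²} = Δ − ∂²_r − 2 ∂_r` at `r = 1`);
* ★ `sphereLaplacian_affine_slice` — for `F = f(x₀ + r ·) − a`: `Δ_{S²} F(σ) = r² Δ f(x) − D²f(x)[y,y] − 2 Df(x)[y]`, `x = x₀ + r σ`, `y = r σ`;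
* ★ `inner_curl_curl_eq_of_link` — for the unthreaded link `curl u = ∇f × (x − x₀)` with `f ∈ C²` at `x`:
  `⟪y, curl (curl u)(x)⟫ = D²f(x)[y,y] − ‖y‖² Δ f(x) + 2 Df(x)[y]` (`curl_cross_apply`, `trace_fderiv_gradient`);
* ★★ `sphereLaplacian_slice_eq_neg_inner_curl_curl` — hence `Δ_{S²}(f(x₀ + r ·) − a)(σ) = −⟪y, curl (curl u)(x₀ + r σ)⟫`, and
  ★ `abs_sphereLaplacian_slice_le` — `|Δ_{S²}(f(x₀ + r ·) − a)(σ)| ≤ r ‖curlCLM‖² K` whenever `u ∈ C²` with `‖D²u(x₀ + r σ)‖ ≤ K`.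

Frozen-time calculus at one point; nothing here is an NS statement; ⟨1222⟩ / W1 / NS regularity OPEN — NOT proved.
`--supports stmt-NavierStokesRegularity-1222 --as helper`.  [folklore]
-/

noncomputable section

-- the summit and its single sub-problem share the name (CONVENTIONS §1)
set_option linter.dupNamespace false

open Set Function Filter Topology InnerProductSpace
open scoped RealInnerProductSpace

namespace Summit.NavierStokesRegularity.NavierStokesRegularity.Theorems.PoloidalLiouville.Indicatrix

open Summit.NavierStokesRegularity.NavierStokesRegularity.Theorems.PoloidalLiouville.NetFlux (E3 exists_orthonormalBasis_radial)
open Literature.Analysis Literature.Analysis.FluidPDE Literature.Analysis.PDE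

/-! ### First-order calculus of the normalisation `N(y) = ‖y‖⁻¹ y` on `ℝ³ ∖ {0}` -/

/-- `d(‖·‖⁻¹)_y = −‖y‖⁻³ ⟪y, ·⟫` on `ℝ³ ∖ {0}` (chain rule through `‖·‖²` and `√`; cf. `Literature/Geometry/Riemannian/SpherePresentation.lean`,
`hasFDerivAt_inv_norm₀`, here on `ℝ³` with the cube written as `(‖y‖⁻¹)³`). [folklore] -/
theorem hasFDerivAt_inv_norm_E3 {y : E3} (hy : y ≠ 0) :
    HasFDerivAt (fun z : E3 => ‖z‖⁻¹) (-((‖y‖⁻¹ ^ 3) • (innerSL ℝ y : E3 →L[ℝ] ℝ))) y := by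
  have hyn : ‖y‖ ≠ 0 := norm_ne_zero_iff.2 hy
  have hy2 : ‖y‖ ^ 2 ≠ 0 := pow_ne_zero 2 hyn
  have hsq : Real.sqrt (‖y‖ ^ 2) = ‖y‖ := Real.sqrt_sq (norm_nonneg y)
  have h1 : HasDerivAt (fun s : ℝ => (Real.sqrt s)⁻¹)
      (-(1 / (2 * Real.sqrt (‖y‖ ^ 2))) / Real.sqrt (‖y‖ ^ 2) ^ 2) (‖y‖ ^ 2) :=
    (Real.hasDerivAt_sqrt hy2).inv (by rw [hsq]; exact hyn)
  have h2 : HasFDerivAt (fun z : E3 => ‖z‖ ^ 2) (2 • (innerSL ℝ y : E3 →L[ℝ] ℝ)) y :=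
    (hasStrictFDerivAt_norm_sq y).hasFDerivAt
  have h3 := h1.comp_hasFDerivAt y h2
  have hfun : (fun z : E3 => ‖z‖⁻¹) = (fun s : ℝ => (Real.sqrt s)⁻¹) ∘ fun z : E3 => ‖z‖ ^ 2 := by
    funext z
    simp only [comp_apply, Real.sqrt_sq (norm_nonneg z)]
  rw [hfun]
  refine h3.congr_fderiv ?_
  rw [hsq, ← Nat.cast_smul_eq_nsmul ℝ, smul_smul, ← neg_smul]
  congr 1
  push_cast
  field_simp

/-- `dN_y = ‖y‖⁻¹ id − ‖y‖⁻³ ⟪y, ·⟫ y` for the normalisation `N(y) = ‖y‖⁻¹ y` at `y ≠ 0` (product rule). [folklore] -/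
theorem hasFDerivAt_normalize_E3 {y : E3} (hy : y ≠ 0) :
    HasFDerivAt (fun z : E3 => ‖z‖⁻¹ • z)
      (‖y‖⁻¹ • ContinuousLinearMap.id ℝ E3 + (-((‖y‖⁻¹ ^ 3) • (innerSL ℝ y : E3 →L[ℝ] ℝ))).smulRight y) y :=
  (hasFDerivAt_inv_norm_E3 hy).smul (hasFDerivAt_id y)

/-- The normalisation is `C^n` away from the origin. [folklore] -/
theorem contDiffAt_normalize_E3 {y : E3} (hy : y ≠ 0) {n : WithTop ℕ∞} :
    ContDiffAt ℝ n (fun z : E3 => ‖z‖⁻¹ • z) y :=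
  ((contDiffAt_norm ℝ hy).inv (norm_ne_zero_iff.2 hy)).smul contDiffAt_id

/-- Away from the origin the derivative of the normalisation applied to a fixed vector `h` is the explicit field
`y ↦ ‖y‖⁻¹ h − (‖y‖⁻¹)³ ⟪h, y⟫ y`. [folklore] -/
theorem fderiv_normalize_apply_eq {y : E3} (hy : y ≠ 0) (h : E3) :
    fderiv ℝ (fun y : E3 => ‖y‖⁻¹ • y) y h = ‖y‖⁻¹ • h - (‖y‖⁻¹ ^ 3 * (innerSL ℝ h) y) • y := by
  rw [(hasFDerivAt_normalize_E3 hy).fderiv]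
  simp only [add_apply, smul_apply, ContinuousLinearMap.id_apply,
    ContinuousLinearMap.smulRight_apply, neg_apply, innerSL_apply_apply, real_inner_comm y h,
    smul_eq_mul, neg_smul, sub_eq_add_neg]

/-! ### The second derivative of the normalisation at a unit vector -/

/-- **`D²N(σ)[k,h] = −⟪σ,k⟫ h − ⟪σ,h⟫ k + (3⟪σ,k⟫⟪σ,h⟫ − ⟪h,k⟫) σ`** for the normalisation `N(y) = ‖y‖⁻¹ y` at a unit vector `σ`
(differentiate `y ↦ ‖y‖⁻¹ h − ‖y‖⁻³ ⟪h,y⟫ y`). [folklore] -/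
theorem fderiv_fderiv_normalize_apply {σ : E3} (hσ : ‖σ‖ = 1) (k h : E3) :
    fderiv ℝ (fderiv ℝ (fun y : E3 => ‖y‖⁻¹ • y)) σ k h =
      (-⟪σ, k⟫) • h - ⟪σ, h⟫ • k + (3 * ⟪σ, k⟫ * ⟪σ, h⟫ - ⟪h, k⟫) • σ := by
  have hσ0 : σ ≠ 0 := by
    intro h0; rw [h0, norm_zero] at hσ; exact zero_ne_one hσ
  set N : E3 → E3 := fun y => ‖y‖⁻¹ • y with hN
  -- `D N` is differentiable at `σ` (`N` is smooth off `0`), so `D²N(σ)[k,h] = D(y ↦ DN(y) h)(σ) k`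
  have hNs : ContDiffAt ℝ 2 N σ := contDiffAt_normalize_E3 hσ0
  have hDN : DifferentiableAt ℝ (fderiv ℝ N) σ :=
    (hNs.fderiv_right (m := 1) (by norm_num)).differentiableAt one_ne_zero
  have happly : fderiv ℝ (fderiv ℝ N) σ k h = fderiv ℝ (fun y => fderiv ℝ N y h) σ k := by
    rw [fderiv_clm_apply hDN (differentiableAt_const h)]
    simp only [fderiv_fun_const, Pi.zero_apply, ContinuousLinearMap.comp_zero, zero_add, ContinuousLinearMap.flip_apply]
  rw [happly]
  -- near `σ`, `DN(y) h` is the explicit field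
  have hev : (fun y => fderiv ℝ N y h) =ᶠ[𝓝 σ] fun y => ‖y‖⁻¹ • h - (‖y‖⁻¹ ^ 3 * (innerSL ℝ h) y) • y := by
    filter_upwards [isOpen_compl_singleton.mem_nhds hσ0] with y hy
    exact fderiv_normalize_apply_eq hy h
  rw [hev.fderiv_eq]
  -- differentiate the explicit field at `σ`
  have h1 : HasFDerivAt (fun y : E3 => ‖y‖⁻¹) (-((‖σ‖⁻¹ ^ 3) • (innerSL ℝ σ : E3 →L[ℝ] ℝ))) σ :=
    hasFDerivAt_inv_norm_E3 hσ0
  have h1h : HasFDerivAt (fun y : E3 => ‖y‖⁻¹ • h) ((-((‖σ‖⁻¹ ^ 3) • (innerSL ℝ σ : E3 →L[ℝ] ℝ))).smulRight h) σ :=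
    h1.smul_const h
  have h3 : HasFDerivAt (fun y : E3 => ‖y‖⁻¹ ^ 3)
      (((3 : ℕ) * ‖σ‖⁻¹ ^ (3 - 1)) • (-((‖σ‖⁻¹ ^ 3) • (innerSL ℝ σ : E3 →L[ℝ] ℝ)))) σ := by
    have h := (hasDerivAt_pow 3 (‖σ‖⁻¹)).comp_hasFDerivAt σ h1
    exact h
  have hi : HasFDerivAt (fun y : E3 => (innerSL ℝ h) y) (innerSL ℝ h) σ := (innerSL ℝ h).hasFDerivAt
  have hc : HasFDerivAt (fun y : E3 => ‖y‖⁻¹ ^ 3 * (innerSL ℝ h) y)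
      ((‖σ‖⁻¹ ^ 3) • innerSL ℝ h +
        (innerSL ℝ h) σ • (((3 : ℕ) * ‖σ‖⁻¹ ^ (3 - 1)) • (-((‖σ‖⁻¹ ^ 3) • (innerSL ℝ σ : E3 →L[ℝ] ℝ))))) σ :=
    h3.mul hi
  have hcy : HasFDerivAt (fun y : E3 => (‖y‖⁻¹ ^ 3 * (innerSL ℝ h) y) • y)
      ((‖σ‖⁻¹ ^ 3 * (innerSL ℝ h) σ) • ContinuousLinearMap.id ℝ E3 +
        ((‖σ‖⁻¹ ^ 3) • innerSL ℝ h +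
          (innerSL ℝ h) σ • (((3 : ℕ) * ‖σ‖⁻¹ ^ (3 - 1)) • (-((‖σ‖⁻¹ ^ 3) • (innerSL ℝ σ : E3 →L[ℝ] ℝ))))).smulRight σ)
      σ :=
    hc.smul (hasFDerivAt_id σ)
  have htot : HasFDerivAt (fun y : E3 => ‖y‖⁻¹ • h - (‖y‖⁻¹ ^ 3 * (innerSL ℝ h) y) • y)
      ((-((‖σ‖⁻¹ ^ 3) • (innerSL ℝ σ : E3 →L[ℝ] ℝ))).smulRight h -
        ((‖σ‖⁻¹ ^ 3 * (innerSL ℝ h) σ) • ContinuousLinearMap.id ℝ E3 +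
          ((‖σ‖⁻¹ ^ 3) • innerSL ℝ h +
            (innerSL ℝ h) σ • (((3 : ℕ) * ‖σ‖⁻¹ ^ (3 - 1)) • (-((‖σ‖⁻¹ ^ 3) • (innerSL ℝ σ : E3 →L[ℝ] ℝ))))).smulRight
              σ)) σ :=
    h1h.sub hcy
  rw [htot.fderiv]
  simp only [sub_apply, add_apply, smul_apply, neg_apply,
    ContinuousLinearMap.smulRight_apply, innerSL_apply_apply, ContinuousLinearMap.id_apply, hσ, inv_one, one_pow,
    smul_eq_mul, mul_one, one_mul, one_smul, Nat.cast_ofNat, real_inner_comm h σ]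
  module

/-- **`D²N(σ)[h,h] = −2⟪σ,h⟫ h + (3⟪σ,h⟫² − ‖h‖²) σ`** at a unit vector `σ`. [folklore] -/
theorem fderiv_fderiv_normalize_apply_self {σ : E3} (hσ : ‖σ‖ = 1) (h : E3) :
    fderiv ℝ (fderiv ℝ (fun y : E3 => ‖y‖⁻¹ • y)) σ h h = (-(2 * ⟪σ, h⟫)) • h + (3 * ⟪σ, h⟫ ^ 2 - ‖h‖ ^ 2) • σ := by
  rw [fderiv_fderiv_normalize_apply hσ h h, real_inner_self_eq_norm_sq]
  module

/-! ### The Laplacian of `F ∘ N` at a unit vector -/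

/-- ★ **Second-order chain rule through the normalisation**: for `‖σ‖ = 1` and `F : ℝ³ → G` of class `C²` at `σ`,
`Δ (y ↦ F(‖y‖⁻¹ y))(σ) = Δ F(σ) − D²F(σ)[σ,σ] − 2 · DF(σ)[σ]` — the classical `Δ_{S²} = Δ − ∂²_r − 2∂_r` at `r = 1`
(chain rule `D²(F ∘ N) = D²F[DN ·, DN ·] + DF ∘ D²N`, `DN(σ) = ` the projection onto `σ⊥`, `Σᵢ D²N(σ)[eᵢ,eᵢ] = −2σ`, summed in a radial
orthonormal frame). [folklore] -/
theorem laplacian_comp_normalize {G : Type*} [NormedAddCommGroup G] [NormedSpace ℝ G]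
    {F : E3 → G} {σ : E3} (hσ : ‖σ‖ = 1) (hF : ContDiffAt ℝ 2 F σ) :
    Laplacian.laplacian (fun y : E3 => F (‖y‖⁻¹ • y)) σ =
      Laplacian.laplacian F σ - fderiv ℝ (fderiv ℝ F) σ σ σ - (2 : ℝ) • fderiv ℝ F σ σ := by
  have hσ0 : σ ≠ 0 := by
    intro h0; rw [h0, norm_zero] at hσ; exact zero_ne_one hσ
  set N : E3 → E3 := fun y => ‖y‖⁻¹ • y with hN
  have hNσ : N σ = σ := by simp [hN, hσ]
  have hNs : ContDiffAt ℝ 2 N σ := contDiffAt_normalize_E3 hσ0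
  have hNd : ∀ y : E3, y ≠ 0 → DifferentiableAt ℝ N y := fun y hy => (hasFDerivAt_normalize_E3 hy).differentiableAt
  -- `F` is `C²` at the points `N y` for `y` near `σ`
  have hFev : ∀ᶠ y in 𝓝 σ, ContDiffAt ℝ 2 F (N y) := by
    have ht : Tendsto N (𝓝 σ) (𝓝 σ) := by
      have := hNs.continuousAt.tendsto; rwa [hNσ] at this
    exact ht.eventually (hF.eventually (by simp))
  -- first derivative of `F ∘ N` near `σ`
  have hG : ∀ᶠ y in 𝓝 σ, HasFDerivAt (fun y => F (N y)) ((fderiv ℝ F (N y)).comp (fderiv ℝ N y)) y := by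
    filter_upwards [hFev, isOpen_compl_singleton.mem_nhds hσ0] with y h1 h2
    exact (h1.differentiableAt (by simp)).hasFDerivAt.comp y (hNd y h2).hasFDerivAt
  have hfd : fderiv ℝ (fun y => F (N y)) =ᶠ[𝓝 σ] fun y => (fderiv ℝ F (N y)).comp (fderiv ℝ N y) :=
    hG.mono fun y h => h.fderiv
  -- second derivative at `σ`
  have hF1 : HasFDerivAt (fderiv ℝ F) (fderiv ℝ (fderiv ℝ F) σ) (N σ) := by
    rw [hNσ]
    exact ((hF.fderiv_right (m := 1) (by norm_num)).differentiableAt one_ne_zero).hasFDerivAt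
  have hc : HasFDerivAt (fun y => fderiv ℝ F (N y)) ((fderiv ℝ (fderiv ℝ F) σ).comp (fderiv ℝ N σ)) σ :=
    hF1.comp σ (hNd σ hσ0).hasFDerivAt
  have hd : HasFDerivAt (fun y => fderiv ℝ N y) (fderiv ℝ (fderiv ℝ N) σ) σ :=
    ((hNs.fderiv_right (m := 1) (by norm_num)).differentiableAt one_ne_zero).hasFDerivAt
  have h2 := hc.clm_comp hd
  have hDD : ∀ h k : E3, fderiv ℝ (fderiv ℝ (fun y => F (N y))) σ h k =
      fderiv ℝ F (N σ) (fderiv ℝ (fderiv ℝ N) σ h k) + fderiv ℝ (fderiv ℝ F) σ (fderiv ℝ N σ h) (fderiv ℝ N σ k) := by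
    intro h k
    rw [hfd.fderiv_eq, h2.fderiv]
    simp only [add_apply, ContinuousLinearMap.comp_apply, ContinuousLinearMap.compL_apply,
      ContinuousLinearMap.flip_apply]
  -- the first derivative of `N` at `σ` is the projection onto `σ⊥`
  have hDN : ∀ k : E3, fderiv ℝ N σ k = k - ⟪σ, k⟫ • σ := by
    intro k
    rw [hN, fderiv_normalize_apply_eq hσ0 k, hσ, inv_one, one_smul, one_pow, one_mul, innerSL_apply_apply,
      real_inner_comm k σ]
  -- a radial orthonormal frame
  obtain ⟨b, hb0, hb1, hb1σ, hb2σ⟩ := exists_orthonormalBasis_radial hσ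
  have hσσ : ⟪σ, σ⟫ = 1 := by rw [real_inner_self_eq_norm_sq, hσ, one_pow]
  have hσ1 : ⟪σ, b 1⟫ = 0 := by rw [real_inner_comm]; exact hb1σ
  have hσ2 : ⟪σ, b 2⟫ = 0 := by rw [real_inner_comm]; exact hb2σ
  have hDN0 : fderiv ℝ N σ (b 0) = 0 := by rw [hDN, hb0, hσσ, one_smul, sub_self]
  have hDN1 : fderiv ℝ N σ (b 1) = b 1 := by rw [hDN, hσ1, zero_smul, sub_zero]
  have hDN2 : fderiv ℝ N σ (b 2) = b 2 := by rw [hDN, hσ2, zero_smul, sub_zero]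
  have hDDN0 : fderiv ℝ (fderiv ℝ N) σ (b 0) (b 0) = 0 := by
    rw [hN, fderiv_fderiv_normalize_apply_self hσ, hb0, hσσ, hσ]; module
  have hDDN1 : fderiv ℝ (fderiv ℝ N) σ (b 1) (b 1) = -σ := by
    rw [hN, fderiv_fderiv_normalize_apply_self hσ, hσ1, hb1 1]; module
  have hDDN2 : fderiv ℝ (fderiv ℝ N) σ (b 2) (b 2) = -σ := by
    rw [hN, fderiv_fderiv_normalize_apply_self hσ, hσ2, hb1 2]; module
  -- both Laplacians in the frame `b`
  rw [laplacian_eq_iteratedFDeriv_orthonormalBasis (fun y : E3 => F (N y)) b,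
    laplacian_eq_iteratedFDeriv_orthonormalBasis F b]
  simp only [iteratedFDeriv_two_apply, Matrix.cons_val_zero, Matrix.cons_val_one, Fin.sum_univ_three]
  rw [hDD, hDD, hDD, hDN0, hDN1, hDN2, hDDN0, hDDN1, hDDN2, hNσ, hb0]
  simp only [map_zero, map_neg, two_smul]
  abel

/-! ### The affine slice `F = f(x₀ + r ·) − a` -/

/-- ★ **The sphere Laplacian of the pulled-back slice potential**: for `f ∈ C²` at `x = x₀ + r σ`, `‖σ‖ = 1`,
`sphereLaplacian (z ↦ f(x₀ + r z) − a) σ = r² Δ f(x) − D²f(x)[rσ, rσ] − 2 Df(x)[rσ]`. [folklore] -/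
theorem sphereLaplacian_affine_slice {f : E3 → ℝ} {x₀ σ : E3} {r a : ℝ} (hσ : ‖σ‖ = 1)
    (hf : ContDiffAt ℝ 2 f (x₀ + r • σ)) :
    sphereLaplacian (fun z => f (x₀ + r • z) - a) σ =
      r ^ 2 * Laplacian.laplacian f (x₀ + r • σ) - fderiv ℝ (fderiv ℝ f) (x₀ + r • σ) (r • σ) (r • σ)
        - 2 * fderiv ℝ f (x₀ + r • σ) (r • σ) := by
  set A : E3 → E3 := fun z => x₀ + r • z with hA
  set F : E3 → ℝ := fun z => f (A z) - a with hF
  set x : E3 := x₀ + r • σ with hx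
  have hAσ : A σ = x := rfl
  have hAd : ∀ z, HasFDerivAt A (r • ContinuousLinearMap.id ℝ E3) z := fun z => by
    have h := ((ContinuousLinearMap.id ℝ E3).hasFDerivAt (x := z)).const_smul r |>.const_add x₀
    simpa [hA] using h
  have hAc : ContDiff ℝ 2 A := by
    show ContDiff ℝ 2 (fun z : E3 => x₀ + r • z)
    exact contDiff_const.add (contDiff_id.const_smul r)
  -- `F` is `C²` at `σ`
  have hFs : ContDiffAt ℝ 2 F σ := by
    have h1 : ContDiffAt ℝ 2 (fun z => f (A z)) σ := hf.comp σ hAc.contDiffAt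
    exact h1.sub contDiffAt_const
  -- the identity of `laplacian_comp_normalize`
  have key := laplacian_comp_normalize (F := F) hσ hFs
  -- derivatives of `F` near `σ`
  have hfev : ∀ᶠ z in 𝓝 σ, DifferentiableAt ℝ f (A z) := by
    have ht : Tendsto A (𝓝 σ) (𝓝 (A σ)) := hAc.continuous.continuousAt.tendsto
    exact ht.eventually ((hf.eventually (by simp)).mono fun y hy => hy.differentiableAt (by simp))
  have hF1 : ∀ᶠ z in 𝓝 σ, HasFDerivAt F ((fderiv ℝ f (A z)).comp (r • ContinuousLinearMap.id ℝ E3)) z := by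
    filter_upwards [hfev] with z hz
    exact (hz.hasFDerivAt.comp z (hAd z)).sub_const a
  have hfdF : fderiv ℝ F =ᶠ[𝓝 σ] fun z => (fderiv ℝ f (A z)).comp (r • ContinuousLinearMap.id ℝ E3) :=
    hF1.mono fun z hz => hz.fderiv
  have hFσ : fderiv ℝ F σ σ = fderiv ℝ f x (r • σ) := by
    rw [hF1.self_of_nhds.fderiv]; simp [hAσ]
  -- second derivative of `F` at `σ`
  have hf2 : HasFDerivAt (fderiv ℝ f) (fderiv ℝ (fderiv ℝ f) x) (A σ) :=
    ((hf.fderiv_right (m := 1) (by norm_num)).differentiableAt one_ne_zero).hasFDerivAt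
  have hc : HasFDerivAt (fun z => fderiv ℝ f (A z)) ((fderiv ℝ (fderiv ℝ f) x).comp (r • ContinuousLinearMap.id ℝ E3)) σ :=
    hf2.comp σ (hAd σ)
  have h2 := hc.clm_comp (hasFDerivAt_const (r • ContinuousLinearMap.id ℝ E3) σ)
  have hDDF : ∀ h k : E3, fderiv ℝ (fderiv ℝ F) σ h k = r * (r * fderiv ℝ (fderiv ℝ f) x h k) := by
    intro h k
    rw [hfdF.fderiv_eq, h2.fderiv]
    simp only [ContinuousLinearMap.comp_apply, ContinuousLinearMap.compL_apply,
      ContinuousLinearMap.flip_apply, ContinuousLinearMap.comp_zero, zero_add,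
      smul_apply, ContinuousLinearMap.id_apply, map_smul, smul_eq_mul]
  -- the Laplacian of `F` at `σ`
  have hΔF : Laplacian.laplacian F σ = r ^ 2 * Laplacian.laplacian f x := by
    rw [laplacian_eq_iteratedFDeriv_orthonormalBasis F (stdOrthonormalBasis ℝ E3),
      laplacian_eq_iteratedFDeriv_orthonormalBasis f (stdOrthonormalBasis ℝ E3)]
    simp only [iteratedFDeriv_two_apply, Matrix.cons_val_zero, Matrix.cons_val_one, hDDF, Finset.mul_sum]
    refine Finset.sum_congr rfl fun i _ => by ring
  have e1 : fderiv ℝ (fderiv ℝ f) x (r • σ) (r • σ) = r * (r * fderiv ℝ (fderiv ℝ f) x σ σ) := by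
    rw [map_smul, map_smul, smul_apply, smul_eq_mul, smul_eq_mul]
  have e2 : fderiv ℝ f x (r • σ) = r * fderiv ℝ f x σ := by rw [map_smul, smul_eq_mul]
  rw [sphereLaplacian, key, hΔF, hDDF, hFσ, e1, e2, smul_eq_mul]

/-! ### The unthreaded link: `⟪y, curl curl u⟫` from the slice potential -/

/-- ★ **`⟪y, curl (curl u)(x)⟫ = D²f(x)[y,y] − ‖y‖² Δf(x) + 2 Df(x)[y]`**, `y = x − x₀`, for the unthreaded link `curl u = ∇f × (· − x₀)`
with `f ∈ C²` at `x`: `curl(∇f × y) = (y·∇)∇f − (Δf) y + 3∇f − ∇f` (`curl_cross_apply`, `tr D∇f = Δf`). [folklore] -/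
theorem inner_curl_curl_eq_of_link {u : E3 → E3} {f : E3 → ℝ} {x₀ x : E3} (hf : ContDiffAt ℝ 2 f x)
    (hlink : ∀ z, curl u z = cross (gradient f z) (z - x₀)) :
    ⟪x - x₀, curl (curl u) x⟫ =
      fderiv ℝ (fderiv ℝ f) x (x - x₀) (x - x₀) - ‖x - x₀‖ ^ 2 * Laplacian.laplacian f x
        + 2 * fderiv ℝ f x (x - x₀) := by
  have hcu : curl u = fun z => cross (gradient f z) (z - x₀) := funext hlink
  -- differentiability of the two factors at `x`
  have hdf : DifferentiableAt ℝ (fderiv ℝ f) x := (hf.fderiv_right (m := 1) (by norm_num)).differentiableAt one_ne_zero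
  have hgrad : gradient f = fun z => (InnerProductSpace.toDual ℝ E3).symm (fderiv ℝ f z) := rfl
  have hW : DifferentiableAt ℝ (gradient f) x := by
    rw [hgrad]
    exact (InnerProductSpace.toDual ℝ E3).symm.toContinuousLinearEquiv.differentiableAt.comp x hdf
  have hΩ : DifferentiableAt ℝ (fun z : E3 => z - x₀) x := differentiableAt_id.sub_const x₀
  have hDΩ : fderiv ℝ (fun z : E3 => z - x₀) x = ContinuousLinearMap.id ℝ E3 := by
    rw [fderiv_sub_const, fderiv_fun_id]
  have hdivΩ : VectorCalculus.divergence (fun z : E3 => z - x₀) x = 3 := by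
    rw [VectorCalculus.divergence, hDΩ, ContinuousLinearMap.coe_id, LinearMap.trace_id, finrank_euclideanSpace_fin]
    norm_num
  have hdivW : VectorCalculus.divergence (gradient f) x = Laplacian.laplacian f x := by
    rw [VectorCalculus.divergence, trace_fderiv_gradient]
  rw [hcu, curl_cross_apply hW hΩ, hDΩ, hdivΩ, hdivW, ContinuousLinearMap.id_apply]
  set y : E3 := x - x₀ with hy
  simp only [inner_sub_right, inner_add_right, inner_smul_right, real_inner_self_eq_norm_sq]
  rw [inner_fderiv_gradient_eq_iteratedFDeriv, iteratedFDeriv_two_apply, real_inner_comm (gradient f x) y,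
    LocalHelmholtz.inner_gradient_left_eq_fderiv]
  simp only [Matrix.cons_val_zero, Matrix.cons_val_one]
  ring

/-- ★★ **Step (v) of the Λ-0b+c bridge**: for the unthreaded link `curl u = ∇f × (· − x₀)` with `f ∈ C²` at `x = x₀ + r σ`, `‖σ‖ = 1`,
`sphereLaplacian (z ↦ f(x₀ + r z) − a) σ = −⟪r σ, curl (curl u)(x₀ + r σ)⟫` — the sphere Laplacian of the pulled-back slice potential is
read off the field `u` (radial parts of `f` cancel). [folklore] -/
theorem sphereLaplacian_slice_eq_neg_inner_curl_curl {u : E3 → E3} {f : E3 → ℝ} {x₀ σ : E3} {r a : ℝ}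
    (hσ : ‖σ‖ = 1) (hf : ContDiffAt ℝ 2 f (x₀ + r • σ)) (hlink : ∀ z, curl u z = cross (gradient f z) (z - x₀)) :
    sphereLaplacian (fun z => f (x₀ + r • z) - a) σ = -⟪r • σ, curl (curl u) (x₀ + r • σ)⟫ := by
  have h1 := sphereLaplacian_affine_slice (a := a) hσ hf
  have h2 := inner_curl_curl_eq_of_link (x := x₀ + r • σ) hf hlink
  rw [add_sub_cancel_left, norm_smul, Real.norm_eq_abs, hσ, mul_one, sq_abs] at h2
  rw [h1, h2]
  ring

/-- ★ **The second-order term of PS07 is controlled by the Hessian of the field**: under the unthreaded link with `u ∈ C²`,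
`f ∈ C²` at `x = x₀ + r σ` (`‖σ‖ = 1`, `r ≥ 0`) and `‖D²u(x)‖ ≤ K`:
`|sphereLaplacian (z ↦ f(x₀ + r z) − a) σ| ≤ r · ‖curlCLM‖² · K` (`‖curl w‖ ≤ ‖curlCLM‖ ‖Dw‖` twice). [folklore] -/
theorem abs_sphereLaplacian_slice_le {u : E3 → E3} {f : E3 → ℝ} {x₀ σ : E3} {r a K : ℝ}
    (hσ : ‖σ‖ = 1) (hr : 0 ≤ r) (hu : ContDiff ℝ 2 u) (hf : ContDiffAt ℝ 2 f (x₀ + r • σ))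
    (hlink : ∀ z, curl u z = cross (gradient f z) (z - x₀)) (hK : ‖iteratedFDeriv ℝ 2 u (x₀ + r • σ)‖ ≤ K) :
    |sphereLaplacian (fun z => f (x₀ + r • z) - a) σ| ≤ r * (‖curlCLM‖ * (‖curlCLM‖ * K)) := by
  rw [sphereLaplacian_slice_eq_neg_inner_curl_curl hσ hf hlink, abs_neg]
  have hcc : ‖curl (curl u) (x₀ + r • σ)‖ ≤ ‖curlCLM‖ * (‖curlCLM‖ * K) :=
    (norm_curl_le (curl u) _).trans
      (mul_le_mul_of_nonneg_left ((norm_fderiv_curl_le hu _).trans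
        (mul_le_mul_of_nonneg_left hK (norm_nonneg curlCLM))) (norm_nonneg curlCLM))
  calc |⟪r • σ, curl (curl u) (x₀ + r • σ)⟫| ≤ ‖r • σ‖ * ‖curl (curl u) (x₀ + r • σ)‖ := abs_real_inner_le_norm _ _
    _ = r * ‖curl (curl u) (x₀ + r • σ)‖ := by rw [norm_smul, Real.norm_eq_abs, abs_of_nonneg hr, hσ, mul_one]
    _ ≤ r * (‖curlCLM‖ * (‖curlCLM‖ * K)) := mul_le_mul_of_nonneg_left hcc hr

end Summit.NavierStokesRegularity.NavierStokesRegularity.Theorems.PoloidalLiouville.Indicatrix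

end
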